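import Mathlib
import Summits.Ventures.PercRepro2.V2SP
import Summits.Ventures.PercRepro2.HallOffFrame
import Summits.Ventures.PercRepro2.HallOffAxis
import Summits.Ventures.PercRepro2.Tail2DCount
import Summits.Ventures.PercRepro2.Tail2DThreePoint
import Summits.Ventures.PercRepro2.Tail2DP2Series
import Summits.Ventures.PercRepro2.Tail2DDisjointPaths
import Summits.Ventures.PercRepro2.Tail2DP2SeriesSP
import Summits.Ventures.PercRepro2.Tail2DAxisUnimodal
import Summits.Ventures.PercRepro2.Tail2DOffAxis31
import Summits.Ventures.PercRepro2.Tail2DRowOne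
import Summits.Ventures.PercRepro2.Tail2DStepRowZero

/-!
# Certified STEP members: the toolbox (seat mine-b, cell pub-perc-repro2; MINE-B.md §37.6)

Tools for landing individual members STEP(i, j) — `#{r = i ∧ b ≥ j} ≤ #{r = i+1 ∧ b ≥ j−1}` — on every
series–parallel pattern from a POINTWISE CERTIFICATE of the parallel step found by linear programming:
the STEP weight of a sum of labels dominates a sum of products (count-valid or count-zero weight of one
factor) × (count-valid or non-negative weight of the other).  Every weight is evaluated on the labels
CAPPED at `K` (`min r K`), which leaves the counts unchanged (`psi_cap`, `phi_cap`, `psi_cap_sum`) and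
makes the pointwise inequality a statement about `(K+1)⁴` tuples, decided by the kernel (`decide`).

* `sum_antisymm_zero`: a weight `f(r,b) − f(b,r)` has count `0` (the colour swap) — the swap differences
  `D(p,q)`, `G(p,q)`, `H(p,q)` of the certificates;
* `sum_mul_prod`: the sum over the product of the configuration spaces of `f(x)·g(y)` is `(Σf)·(Σg)`;
* `tail_le_of_steps`: the anti-diagonal comparison `T(i,j) ≤ T(i+1,j−1)` from the members `STEP(k, j)`,
  `i ≤ k ≤ j−2` (the telescoping of registry §10.3; `T(j−1,j) = T(j,j−1)` by the swap) — the input of the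
  series step `step_ser`;
* `step_diag_iff`: on the diagonal `j = i+2`, STEP(i, i+2) is the anti-diagonal member `T(i+2,i) ≤ T(i+1,i+1)`.
-/

namespace Summit.Ventures.PercRepro2.Tail2D

open V2Closure

section Swap

variable (s : V2Closure.SP)

/-- the sum of an antisymmetric weight `f(r,b) − f(b,r)` vanishes -/
lemma sum_antisymm_zero (f : ℕ → ℕ → ℤ) :
    ∑ x, (f (s.rLab x) (s.bLab x) - f (s.bLab x) (s.rLab x)) = 0 := by
  rw [Finset.sum_sub_distrib]
  have e : ∑ x, f (s.bLab x) (s.rLab x) = ∑ x, f (s.rLab x) (s.bLab x) := by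
    refine Fintype.sum_equiv (Function.Involutive.toPerm (swapConf s) (swapConf_swapConf s)) _ _ (fun x => ?_)
    show f (s.bLab x) (s.rLab x) = f (s.rLab (swapConf s x)) (s.bLab (swapConf s x))
    rw [rLab_swapConf, bLab_swapConf]
  rw [e, sub_self]

/-- the sum of a weight and the sum of its swap agree -/
lemma sum_swap_eq (f : ℕ → ℕ → ℤ) :
    ∑ x, f (s.bLab x) (s.rLab x) = ∑ x, f (s.rLab x) (s.bLab x) := by
  have h := sum_antisymm_zero s f
  rw [Finset.sum_sub_distrib] at h
  linarith

/-- the offset-one STEP weight `psi k (k+1)` has the count of `psi k (k+2)`: their difference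
`[r = k+1 ∧ b = k] − [r = k ∧ b = k+1]` is antisymmetric -/
lemma sum_psi_offset_one (k : ℕ) :
    ∑ x, psi k (k + 1) (s.rLab x) (s.bLab x) = ∑ x, psi k (k + 2) (s.rLab x) (s.bLab x) := by
  have h := sum_antisymm_zero s (fun a c => if a = k + 1 ∧ c = k then (1 : ℤ) else 0)
  have e : ∑ x, psi k (k + 1) (s.rLab x) (s.bLab x)
      = ∑ x, psi k (k + 2) (s.rLab x) (s.bLab x)
        + ∑ x, ((if s.rLab x = k + 1 ∧ s.bLab x = k then (1 : ℤ) else 0)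
          - (if s.bLab x = k + 1 ∧ s.rLab x = k then (1 : ℤ) else 0)) := by
    rw [← Finset.sum_add_distrib]
    refine Finset.sum_congr rfl (fun x _ => ?_)
    unfold psi
    split_ifs <;> omega
  rw [e, h, add_zero]

end Swap

section Cap

/-- capping the labels at `K` does not change the STEP weight `psi k l` when `k + 1 < K` and `l ≤ K` -/
lemma psi_cap (k l K r b : ℕ) (hk : k + 1 < K) (hl : l ≤ K) :
    psi k l (min r K) (min b K) = psi k l r b := by
  unfold psi; split_ifs <;> omega

/-- capping the labels at `K` does not change the weight `phi m j` when `m ≤ K` and `j + 1 ≤ K` -/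
lemma phi_cap (m j K r b : ℕ) (hm : m ≤ K) (hj : j + 1 ≤ K) :
    phi m j (min r K) (min b K) = phi m j r b := by
  unfold phi; split_ifs <;> omega

/-- the STEP weight of the sums of labels depends only on the capped labels (`i + 2 ≤ K`, `j ≤ K`) -/
lemma psi_cap_sum (i j K r b u v : ℕ) (hi : i + 2 ≤ K) (hj : j ≤ K) :
    psi i j (min r K + min u K) (min b K + min v K) = psi i j (r + u) (b + v) := by
  unfold psi; split_ifs <;> omega

end Cap

section Product

variable (s t : V2Closure.SP)

/-- the sum over the product of `f(x)·g(y)` is the product of the sums -/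
lemma sum_mul_prod (f : s.Conf → ℤ) (g : t.Conf → ℤ) :
    ∑ p : s.Conf × t.Conf, f p.1 * g p.2 = (∑ x, f x) * (∑ y, g y) := by
  rw [Finset.sum_mul_sum, ← Fintype.sum_prod_type']

/-- a product of two weights with non-negative sums has a non-negative sum over the product -/
lemma sum_mul_prod_nonneg (f : s.Conf → ℤ) (g : t.Conf → ℤ) (hf : 0 ≤ ∑ x, f x) (hg : 0 ≤ ∑ y, g y) :
    0 ≤ ∑ p : s.Conf × t.Conf, f p.1 * g p.2 := by
  rw [sum_mul_prod]; exact mul_nonneg hf hg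

/-- a product with a weight of sum `0` has sum `0` over the product (either factor) -/
lemma sum_mul_prod_zero_left (f : s.Conf → ℤ) (g : t.Conf → ℤ) (hf : ∑ x, f x = 0) :
    ∑ p : s.Conf × t.Conf, f p.1 * g p.2 = 0 := by
  rw [sum_mul_prod, hf, zero_mul]

/-- a product with a weight of sum `0` has sum `0` over the product (either factor) -/
lemma sum_mul_prod_zero_right (f : s.Conf → ℤ) (g : t.Conf → ℤ) (hg : ∑ y, g y = 0) :
    ∑ p : s.Conf × t.Conf, f p.1 * g p.2 = 0 := by
  rw [sum_mul_prod, hg, mul_zero]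

end Product

section Telescoping

variable (s : V2Closure.SP)

/-- `T(a,j) = H(a,j) + T(a+1,j)` -/
lemma tail_split_H (a j : ℕ) :
    (Finset.univ.filter (fun y : s.Conf => a ≤ s.rLab y ∧ j ≤ s.bLab y)).card
      = (Finset.univ.filter (fun y : s.Conf => s.rLab y = a ∧ j ≤ s.bLab y)).card
        + (Finset.univ.filter (fun y : s.Conf => a + 1 ≤ s.rLab y ∧ j ≤ s.bLab y)).card := by
  rw [Finset.card_filter, Finset.card_filter, Finset.card_filter, ← Finset.sum_add_distrib]
  refine Finset.sum_congr rfl (fun y _ => ?_)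
  split_ifs <;> omega

/-- `T(a,b) = T(b,a)` (the colour swap) -/
lemma tail_symm (a b : ℕ) :
    (Finset.univ.filter (fun y : s.Conf => a ≤ s.rLab y ∧ b ≤ s.bLab y)).card
      = (Finset.univ.filter (fun y : s.Conf => b ≤ s.rLab y ∧ a ≤ s.bLab y)).card := by
  rw [← card_swap s (fun r b' => b ≤ r ∧ a ≤ b')]
  congr 1; ext y; simp only [Finset.mem_filter, Finset.mem_univ, true_and]; exact and_comm

/-- **the anti-diagonal comparison from STEP**: `T(i,j) ≤ T(i+1,j−1)` follows from the members
`STEP(k, j)` for `i ≤ k ≤ j−2` (induction on `j − 2 − i`; the last step `T(j−1,j) = T(j,j−1)` is the swap) -/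
lemma tail_le_of_steps (j : ℕ) : ∀ (n i : ℕ), i + n + 2 = j →
    (∀ k, i ≤ k → k + 2 ≤ j →
      (Finset.univ.filter (fun y : s.Conf => s.rLab y = k ∧ j ≤ s.bLab y)).card
        ≤ (Finset.univ.filter (fun y : s.Conf => s.rLab y = k + 1 ∧ j - 1 ≤ s.bLab y)).card) →
    (Finset.univ.filter (fun y : s.Conf => i ≤ s.rLab y ∧ j ≤ s.bLab y)).card
      ≤ (Finset.univ.filter (fun y : s.Conf => i + 1 ≤ s.rLab y ∧ j - 1 ≤ s.bLab y)).card
  | 0, i, hij, h => by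
    -- `i = j − 2`: `T(j−2,j) = H(j−2,j) + T(j−1,j)`, `T(j−1,j−1) = H(j−1,j−1) + T(j,j−1)`, `T(j−1,j) = T(j,j−1)`
    rw [tail_split_H s i j, tail_split_H s (i + 1) (j - 1)]
    have hs := h i le_rfl (by omega)
    have e : (Finset.univ.filter (fun y : s.Conf => i + 1 ≤ s.rLab y ∧ j ≤ s.bLab y)).card
        = (Finset.univ.filter (fun y : s.Conf => i + 1 + 1 ≤ s.rLab y ∧ j - 1 ≤ s.bLab y)).card := by
      rw [tail_symm s (i + 1 + 1) (j - 1)]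
      congr 1; apply Finset.filter_congr; intro y _; omega
    omega
  | n + 1, i, hij, h => by
    rw [tail_split_H s i j, tail_split_H s (i + 1) (j - 1)]
    have hs := h i le_rfl (by omega)
    have ih := tail_le_of_steps j n (i + 1) (by omega) (fun k hk hkj => h k (by omega) hkj)
    omega

/-- on the diagonal `j = i + 2`, STEP(i, i+2) is the anti-diagonal member `T(i+2, i) ≤ T(i+1, i+1)` -/
lemma step_diag_iff (i : ℕ) :
    (Finset.univ.filter (fun y : s.Conf => s.rLab y = i ∧ i + 2 ≤ s.bLab y)).card
        ≤ (Finset.univ.filter (fun y : s.Conf => s.rLab y = i + 1 ∧ i + 2 - 1 ≤ s.bLab y)).card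
      ↔ (Finset.univ.filter (fun y : s.Conf => i + 2 ≤ s.rLab y ∧ i ≤ s.bLab y)).card
        ≤ (Finset.univ.filter (fun y : s.Conf => i + 1 ≤ s.rLab y ∧ i + 1 ≤ s.bLab y)).card := by
  have e1 := tail_split_H s i (i + 2)
  have e2 := tail_split_H s (i + 1) (i + 1)
  have e3 : (Finset.univ.filter (fun y : s.Conf => i + 1 ≤ s.rLab y ∧ i + 2 ≤ s.bLab y)).card
      = (Finset.univ.filter (fun y : s.Conf => i + 1 + 1 ≤ s.rLab y ∧ i + 1 ≤ s.bLab y)).card := by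
    rw [tail_symm s (i + 1 + 1) (i + 1)]
  have e4 := tail_symm s (i + 2) i
  have e5 : (Finset.univ.filter (fun y : s.Conf => s.rLab y = i + 1 ∧ i + 2 - 1 ≤ s.bLab y)).card
      = (Finset.univ.filter (fun y : s.Conf => s.rLab y = i + 1 ∧ i + 1 ≤ s.bLab y)).card := rfl
  rw [e5]
  omega

end Telescoping

end Summit.Ventures.PercRepro2.Tail2D
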